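import Summits.BirchSwinnertonDyer.Rank1Residual.Additive.CyclotomicGoodReduction
import Mathlib.NumberTheory.NumberField.Cyclotomic.Ideal
import HarnessLib

/-!
# The wild analogue `(G₉)` at `3`: geometric kernel I — translate, scale, twist-free bookkeeping

Route `CyclotomicUntwist` (sub-problem `BirchSwinnertonDyer`), crux `PSRankOneLowerHalfAtThree`
(item stmt-BirchSwinnertonDyer-21580), registered line `birth`, stub `stub_gNineCriterion`
(the route's FIRST LEMMA `GNineCriterion`: on the wild cell at `3`, a `3`-adic-square minimal
discriminant forces good reduction over `ℚ(ζ₉)`, i.e. the tree's `TypeGNine`). This file and its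
sequel `CyclotomicUntwistGNineKernelNine.lean` are the `p = 3` (wild) analogue of
`Additive/CyclotomicGoodReduction.lean` (`hasGoodReductionAt_of_valuation_j_le_one_of_valuation_pow_twelve`,
residue characteristic `≥ 5`): in residue characteristic `3` a twelfth root of the discriminant
valuation is NOT enough — one needs an APPROXIMATE ROOT `r` of the `2`-division cubic
`x³ + A x² + B x + C` to precision `v(Δ)/6` (`v(value at r) ≥ v/2`, `v(derivative at r) ≥ v/3`,
`v(A + 3r) ≥ v/6`); translating by `r` and scaling by `u` with `v(u) = v/12` then gives an
integral model with unit discriminant.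

Contents (theorems only; no definition, no named fact; nothing about BSD is asserted):
* `hasGoodReductionAt_of_translate_scale` — the valuation form of "translate by `r`, scale by `u`";
* `hasGoodReductionAt_iff_translate` — translation invariance;
* `hasGoodReductionAt_iff_cubicModel` — completing the square: `y² + a₁xy + a₃y = …` ↦
  `y² = x³ + b₂x² + 8b₄x + 16b₆`;
* `placeData_nine` — at a place `w ∋ 3` of a `9`-th cyclotomic field: `w(ζ−1) = exp(−1)`,
  `w(3) = exp(−6)`, `w(n) = 1` for `3 ∤ n` (Mathlib: the prime over `3` is `(ζ − 1)`, `e = 6`).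

References: J. H. Silverman, *AEC* VII.1 (change of variables), VII.5.1; J. Tate, Algorithm for
determining the type of a singular fiber (Antwerp IV, 1975); L. Washington, *Cyclotomic Fields*,
Lemma 1.4, Prop. 2.3 (ramification of `3` in `ℚ(ζ₉)`).
-/

noncomputable section

open scoped Classical NumberField

open WeierstrassCurve IsDedekindDomain IsDedekindDomain.HeightOneSpectrum NumberField
  WithZero

set_option linter.dupNamespace false

namespace Summit.BirchSwinnertonDyer.BirchSwinnertonDyer.Theorems.GNineCriterion

section Generic

variable {F : Type*} [Field F] [NumberField F] (w : HeightOneSpectrum (𝓞 F))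

omit [NumberField F] in
/-- The discriminant of `y² = x³ + A x² + B x + C` is `16·disc(x³ + A x² + B x + C)`.
[cite: SilvermanAEC2009, III.1] -/
theorem Δ_cubicModel (A B C : F) :
    (⟨0, A, 0, B, C⟩ : WeierstrassCurve F).Δ =
      16 * (A ^ 2 * B ^ 2 - 4 * B ^ 3 - 4 * A ^ 3 * C - 27 * C ^ 2 + 18 * A * B * C) := by
  simp only [WeierstrassCurve.Δ, WeierstrassCurve.b₂, WeierstrassCurve.b₄, WeierstrassCurve.b₆,
    WeierstrassCurve.b₈]
  ring

/-- Valuation of an integer is at most `1`. [folklore] -/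
theorem val_intCast_le (n : ℤ) : w.valuation F (n : F) ≤ 1 := by
  have : (n : F) = algebraMap (𝓞 F) F (n : 𝓞 F) := by simp
  rw [this]; exact valuation_le_one w _

/-- Ultrametric inequality, packaged. [folklore] -/
theorem val_add_le {x y : F} {g : ℤᵐ⁰} (hx : w.valuation F x ≤ g) (hy : w.valuation F y ≤ g) :
    w.valuation F (x + y) ≤ g :=
  (Valuation.map_add _ _ _).trans (max_le hx hy)

/-- `w(u⁻ᵏ x) ≤ 1` from `w(x) ≤ w(u)ᵏ`. [folklore] -/
theorem val_scale_le {x u : F} (hu : u ≠ 0) (k : ℕ) (h : w.valuation F x ≤ w.valuation F u ^ k) :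
    w.valuation F (u⁻¹ ^ k * x) ≤ 1 := by
  have hu' : w.valuation F u ≠ 0 := (Valuation.ne_zero_iff _).mpr hu
  have hpos : 0 < w.valuation F u ^ k := pow_pos (zero_lt_iff.mpr hu') k
  rw [map_mul, map_pow, map_inv₀, inv_pow, ← div_eq_inv_mul]
  exact (div_le_one₀ hpos).mpr h

/-- **Translate by `r`, scale by `u`.** If the translated-and-scaled coefficients
`(A + 3r)/u²`, `(B + 2rA + 3r²)/u⁴`, `(C + rB + r²A + r³)/u⁶` of `y² = x³ + A x² + B x + C` are
`w`-integral and `Δ/u¹²` is a `w`-unit, the curve has good reduction at `w`.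
[cite: SilvermanAEC2009, VII.1 and VII.5.1(a)] -/
theorem hasGoodReductionAt_of_translate_scale (A B C r u : F) (hu : u ≠ 0)
    (e2 : w.valuation F (A + 3 * r) ≤ w.valuation F u ^ 2)
    (e4 : w.valuation F (B + 2 * r * A + 3 * r ^ 2) ≤ w.valuation F u ^ 4)
    (e6 : w.valuation F (C + r * B + r ^ 2 * A + r ^ 3) ≤ w.valuation F u ^ 6)
    (eΔ : w.valuation F
      (16 * (A ^ 2 * B ^ 2 - 4 * B ^ 3 - 4 * A ^ 3 * C - 27 * C ^ 2 + 18 * A * B * C)) =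
        w.valuation F u ^ 12) :
    (⟨0, A, 0, B, C⟩ : WeierstrassCurve F).HasGoodReductionAt w := by
  set V : WeierstrassCurve F := ⟨0, A, 0, B, C⟩ with hVdef
  set Cv : VariableChange F := ⟨Units.mk0 u hu, r, 0, 0⟩ with hCv
  have hCu : (↑Cv.u⁻¹ : F) = u⁻¹ := by rw [Units.val_inv_eq_inv_val, hCv, Units.val_mk0]
  have ha₁ : (Cv • V).a₁ = 0 := by
    rw [variableChange_a₁]; simp only [hCv, hVdef]; ring
  have ha₃ : (Cv • V).a₃ = 0 := by
    rw [variableChange_a₃]; simp only [hCv, hVdef]; ring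
  have ha₂ : (Cv • V).a₂ = u⁻¹ ^ 2 * (A + 3 * r) := by
    rw [variableChange_a₂, hCu]; simp only [hCv, hVdef]; ring
  have ha₄ : (Cv • V).a₄ = u⁻¹ ^ 4 * (B + 2 * r * A + 3 * r ^ 2) := by
    rw [variableChange_a₄, hCu]; simp only [hCv, hVdef]; ring
  have ha₆ : (Cv • V).a₆ = u⁻¹ ^ 6 * (C + r * B + r ^ 2 * A + r ^ 3) := by
    rw [variableChange_a₆, hCu]; simp only [hCv, hVdef]; ring
  have hΔ' : (Cv • V).Δ = u⁻¹ ^ 12 * V.Δ := by rw [variableChange_Δ, hCu]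
  have hu' : w.valuation F u ≠ 0 := (Valuation.ne_zero_iff _).mpr hu
  have eΔ' : w.valuation F (Cv • V).Δ = 1 := by
    rw [hΔ', map_mul, map_pow, map_inv₀, hVdef, Δ_cubicModel, eΔ, inv_pow,
      inv_mul_cancel₀ (pow_ne_zero _ hu')]
  have hgood' : (Cv • V).HasGoodReductionAt w :=
    (Cv • V).hasGoodReductionAt_of_valuation_le_one_of_valuation_Δ_eq_one w
      (by rw [ha₁, map_zero]; exact zero_le_one) (by rw [ha₂]; exact val_scale_le w hu 2 e2)
      (by rw [ha₃, map_zero]; exact zero_le_one) (by rw [ha₄]; exact val_scale_le w hu 4 e4)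
      (by rw [ha₆]; exact val_scale_le w hu 6 e6) eΔ'
  exact (hasGoodReductionAt_smul_iff_holds w V Cv).mp hgood'

/-- **Translation invariance**: `y² = x³ + A x² + B x + C` has good reduction at `w` iff its
translate by `t` does. [cite: SilvermanAEC2009, VII.1] -/
theorem hasGoodReductionAt_iff_translate (A B C t : F) :
    (⟨0, A, 0, B, C⟩ : WeierstrassCurve F).HasGoodReductionAt w ↔
      (⟨0, A + 3 * t, 0, B + 2 * t * A + 3 * t ^ 2, C + t * B + t ^ 2 * A + t ^ 3⟩ :
        WeierstrassCurve F).HasGoodReductionAt w := by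
  set V : WeierstrassCurve F := ⟨0, A, 0, B, C⟩ with hVdef
  set Cv : VariableChange F := ⟨1, t, 0, 0⟩ with hCv
  have hCV : Cv • V =
      ⟨0, A + 3 * t, 0, B + 2 * t * A + 3 * t ^ 2, C + t * B + t ^ 2 * A + t ^ 3⟩ := by
    ext
    · simp [variableChange_a₁, hCv, hVdef]
    · simp [variableChange_a₂, hCv, hVdef]
    · simp [variableChange_a₃, hCv, hVdef]
    · simp [variableChange_a₄, hCv, hVdef]
    · simp [variableChange_a₆, hCv, hVdef]
  rw [← hCV]
  exact (hasGoodReductionAt_smul_iff_holds w V Cv).symm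

/-- **Completing the square** (characteristic `≠ 2`): a Weierstrass equation with coefficients
`a₁,…,a₆` has good reduction at `w` iff the model `y² = x³ + b₂ x² + 8 b₄ x + 16 b₆` does
(`u = 1/2`, `s = −a₁/2`, `t = −a₃/2`). [cite: SilvermanAEC2009, III.1] -/
theorem hasGoodReductionAt_iff_cubicModel (V : WeierstrassCurve F) :
    V.HasGoodReductionAt w ↔
      (⟨0, V.b₂, 0, 8 * V.b₄, 16 * V.b₆⟩ : WeierstrassCurve F).HasGoodReductionAt w := by
  have h2 : (2 : F) ≠ 0 := two_ne_zero
  have h2' : (2 : F)⁻¹ ≠ 0 := inv_ne_zero h2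
  set Cv : VariableChange F := ⟨Units.mk0 (2 : F)⁻¹ h2', 0, -V.a₁ / 2, -V.a₃ / 2⟩ with hCv
  have hCu : (↑Cv.u⁻¹ : F) = 2 := by
    rw [Units.val_inv_eq_inv_val, hCv, Units.val_mk0, inv_inv]
  have hCV : Cv • V = ⟨0, V.b₂, 0, 8 * V.b₄, 16 * V.b₆⟩ := by
    ext
    · rw [variableChange_a₁, hCu]; simp only [hCv]; field_simp; ring
    · rw [variableChange_a₂, hCu]; simp only [hCv, WeierstrassCurve.b₂]; field_simp; ring
    · rw [variableChange_a₃, hCu]; simp only [hCv]; field_simp; ring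
    · rw [variableChange_a₄, hCu]; simp only [hCv, WeierstrassCurve.b₄]; field_simp; ring
    · rw [variableChange_a₆, hCu]; simp only [hCv, WeierstrassCurve.b₆]; field_simp; ring
  rw [← hCV]
  exact (hasGoodReductionAt_smul_iff_holds w V Cv).symm

end Generic

section Place

variable {F : Type*} [Field F] [NumberField F]

/-- **Place data at `w ∋ 3` of a `9`-th cyclotomic field**: the prime over `3` is `(ζ − 1)`
(Mathlib `IsCyclotomicExtension.Rat.eq_span_zeta_sub_one_of_liesOver`), totally ramified with
`e = 6` (`ramificationIdx_eq_of_prime_pow`), so `w(ζ − 1) = exp(−1)`, `w(3) = exp(−6)` and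
integers prime to `3` are `w`-units. [folklore] -/
theorem placeData_nine [hF : IsCyclotomicExtension {3 ^ (1 + 1)} ℚ F]
    (w : HeightOneSpectrum (𝓞 F)) (hw : (3 : 𝓞 F) ∈ w.asIdeal) :
    w.valuation F ((IsCyclotomicExtension.zeta (3 ^ (1 + 1)) ℚ F) - 1) = exp (-1 : ℤ) ∧
    w.valuation F (3 : F) = exp (-6 : ℤ) ∧
    (∀ n : ℤ, ¬ (3 : ℤ) ∣ n → w.valuation F (n : F) = 1) := by
  haveI : Fact (Nat.Prime 3) := ⟨Nat.prime_three⟩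
  set ζ' := IsCyclotomicExtension.zeta (3 ^ (1 + 1)) ℚ F with hζdef
  have hζ' : IsPrimitiveRoot ζ' (3 ^ (1 + 1)) := IsCyclotomicExtension.zeta_spec (3 ^ (1 + 1)) ℚ F
  have hunder : w.asIdeal.under ℤ = Ideal.span {((3 : ℕ) : ℤ)} := by
    have hle : Ideal.span {((3 : ℕ) : ℤ)} ≤ w.asIdeal.under ℤ := by
      rw [Ideal.span_le, Set.singleton_subset_iff, SetLike.mem_coe, Ideal.under_def,
        Ideal.mem_comap, map_natCast]
      exact hw
    have hmax : (Ideal.span {((3 : ℕ) : ℤ)}).IsMaximal := by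
      have hp : Prime ((3 : ℕ) : ℤ) := by norm_num
      exact ((Ideal.span_singleton_prime hp.ne_zero).mpr hp).isMaximal (by simp)
    exact (hmax.eq_of_le (Ideal.IsPrime.ne_top inferInstance) hle).symm
  haveI hlies : w.asIdeal.LiesOver (Ideal.span {((3 : ℕ) : ℤ)}) := ⟨hunder.symm⟩
  have hspan : w.asIdeal = Ideal.span {hζ'.toInteger - 1} :=
    IsCyclotomicExtension.Rat.eq_span_zeta_sub_one_of_liesOver 3 1 F hζ' w.asIdeal
  have hπ0 : hζ'.toInteger - 1 ≠ 0 := hζ'.zeta_sub_one_prime.ne_zero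
  have hv1 : w.valuation F (ζ' - 1) = exp (-1 : ℤ) := by
    have := intValuation_singleton w hπ0 hspan
    rw [← valuation_of_algebraMap (K := F)] at this
    simpa using this
  refine ⟨hv1, ?_, ?_⟩
  · set v : HeightOneSpectrum ℤ :=
      (Rat.HeightOneSpectrum.primesEquiv (R := ℤ)).symm ⟨3, Nat.prime_three⟩ with hvdef
    have hv : Rat.HeightOneSpectrum.natGenerator v = 3 :=
      congrArg Subtype.val
        ((Rat.HeightOneSpectrum.primesEquiv (R := ℤ)).apply_symm_apply ⟨3, Nat.prime_three⟩)
    have hvspan : v.asIdeal = Ideal.span {((3 : ℕ) : ℤ)} := by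
      rw [Rat.HeightOneSpectrum.asIdeal_eq_span_natGenerator_int, hv]
    haveI hlies' : w.asIdeal.LiesOver v.asIdeal := by rw [hvspan]; exact hlies
    have hpbot : Ideal.span {((3 : ℕ) : ℤ)} ≠ ⊥ := by
      rw [Ne, Ideal.span_singleton_eq_bot]; norm_num
    have he : v.asIdeal.ramificationIdx' w.asIdeal = 6 := by
      rw [hvspan, Ideal.ramificationIdx'_eq_ramificationIdx _ _ hpbot,
        IsCyclotomicExtension.Rat.ramificationIdx_eq_of_prime_pow 3 1 F w.asIdeal]
      norm_num
    have h3Q : (3 : F) = algebraMap ℚ F 3 := by simp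
    have h33 : padicValRat 3 (3 : ℚ) = 1 := by
      have := padicValRat.self (p := 3) (by norm_num)
      simpa using this
    rw [h3Q, ← valuation_liesOver (K := ℚ) (L := F) v w (3 : ℚ), he,
      Rat.HeightOneSpectrum.valuation_eq_exp_neg_padicValRat v (by norm_num), hv, h33, ← exp_nsmul]
    norm_num
  · intro n hn
    have hn' : (n : F) = algebraMap (𝓞 F) F (n : 𝓞 F) := by simp
    rw [hn', valuation_eq_one_iff_notMem]
    intro hmem
    have : (n : ℤ) ∈ w.asIdeal.under ℤ := by
      rw [Ideal.under_def, Ideal.mem_comap, eq_intCast]; exact hmem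
    rw [hunder, Ideal.mem_span_singleton] at this
    exact hn (by exact_mod_cast this)

end Place

end Summit.BirchSwinnertonDyer.BirchSwinnertonDyer.Theorems.GNineCriterion

end
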